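import Literature.NumberTheory.EllipticCurves.GaussianLatticeQuarterValues
import Literature.NumberTheory.EllipticCurves.ComplexTorusAddProofs
import Literature.NumberTheory.EllipticCurves.WeierstrassTorsion
import HarnessLib

/-!
# The Gaussian lattice `ℤi + ℤ`: `3`-division values of `℘` and the twisted Eisenstein sum
# over the `3`-torsion

Topic `Literature/NumberTheory/EllipticCurves` (Gaussian-lattice cluster), sequel to
`GaussianLatticeQuarterValues` (quarter-period values, `E₁*(z) = ζ(z) − π z̄ = kroneckerE₁ z`).
Filed for the named fact `Literature.NumberTheory.EllipticCurves.BirchSwinnertonDyer1965_L_one_one_three`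
(`L(E₁, 1) = β/4`, `L(E₃, 1) = β/√3`, Tunnell 1983 p. 329 quoting Birch–Swinnerton-Dyer 1965,
Table 1): the curve `E₃ : y² = x³ − 9x` is the twist of `E₁` by the quadratic character of
conductor `3`, and by the finite formula for weight-one Hecke `L`-values of `ℚ(i)`
(`GaussianLatticeHeckeLValue`) `L(E₃, 1)` is a combination of the numbers `E₁*(w + v)`, `w` a
primary quarter class, `v` running over the eight non-zero `3`-division points of `Λ = ℤi + ℤ`
weighted by the quadratic character `κ` of `ℤ[i]/3 ≅ 𝔽₉` (`+1` on `±1, ±i`, `−1` on `±1 ± i`).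
We prove (`Λ = ℤi + ℤ`, `ϖ₀ = Γ(1/4)²/(2√(2π))`, `e₁ = ϖ₀²`, `g₂ = 4ϖ₀⁴`, `g₃ = 0`):

* `three_div_quartic` — **`3`-division equation**: if `v ∉ Λ`, `3v ∈ Λ` then
  `3℘(v)⁴ − 6ϖ₀⁴℘(v)² − ϖ₀⁸ = 0` (from `℘(2v) = ℘(−v)` and the duplication formula; for a general
  lattice `12℘⁴ − 6g₂℘² − 12g₃℘ − g₂²/4 = 0`, `PeriodPair.twelve_mul_weierstrassP_pow_four_of_three_mul_mem`);
* `weierstrassP_third_sq`, `weierstrassP_one_add_I_third_sq` — `℘(1/3)² = (3 + 2√3)ϖ₀⁴/3`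
  (`℘(1/3)` is real) and `℘((1+i)/3)² = (3 − 2√3)ϖ₀⁴/3` (`℘((1+i)/3)` is purely imaginary), the
  two roots of `3X² − 6ϖ₀⁴X − ϖ₀⁸`; with `℘(i/3) = −℘(1/3)`, `℘((1−i)/3) = −℘((1+i)/3)`;
* `derivWeierstrassP_three_add_two_I_quarter` — `℘'((3+2i)/4) = −2(2 − √2)ϖ₀³` (addition
  theorem for `℘'` at `1/4 + (1+i)/2`);
* `kroneckerE₁_add_add_sub` — `E₁*(u+v) + E₁*(u−v) − 2E₁*(u) = ℘'(u)/(℘(u) − ℘(v))`;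
* `kroneckerE₁_twisted_three_torsion_sum` — **the twisted sum over `E[3] ∖ 0`**: for `w ∉ Λ`
  with `D(w) = 3℘(w)⁴ − 6ϖ₀⁴℘(w)² − ϖ₀⁸ ≠ 0`,
  `∑_{v} κ(v) E₁*(w + v) = 8√3 ϖ₀⁴ ℘(w)℘'(w)/D(w)`
  (pairing `v` with `−v`; only the squares `℘(v)²` enter);
* `twistedSum_quarter`, `twistedSum_three_add_two_I_quarter` — its values `−2√3 ϖ₀` at
  `w = 1/4` and at `w = (3+2i)/4`.

Everything is proved; there are no new definitions besides the abbreviation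
`threeTorsionTwistedSum`, and no named facts.

## References

* B. J. Birch, H. P. F. Swinnerton-Dyer, *Notes on elliptic curves. II*, J. reine angew. Math.
  218 (1965) 79–108, §3 and Table 1 (`D = 9`).
* J. B. Tunnell, *A classical Diophantine problem and modular forms of weight 3/2*, Invent.
  Math. 72 (1983), p. 329.
* E. T. Whittaker, G. N. Watson, *A Course of Modern Analysis*, 4th ed., §20.33, Example 20.5.3.
-/

noncomputable section

open Complex PeriodPair Real Set Filter
open scoped Real Topology PeriodPair ComplexConjugate

namespace Literature.NumberTheory.EllipticCurves

namespace GaussianLattice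

local notation "Λᵢ" => PeriodPair.ofUpperHalfPlane UpperHalfPlane.I

local notation "ϖ₀" => (Real.Gamma (1 / 4) ^ 2 / (2 * Real.sqrt (2 * π)) : ℝ)

/-! ### The `3`-division equation -/

/-- **`3`-division equation for a general lattice**: if `v ∉ Λ` and `3v ∈ Λ` then
`12℘(v)⁴ − 6g₂℘(v)² − 12g₃℘(v) − g₂²/4 = 0`. Indeed `2v ∉ Λ`, so `℘'(v) ≠ 0` and the
duplication formula `℘(2v) = ¼(℘''(v)/℘'(v))² − 2℘(v)` applies, while `℘(2v) = ℘(3v − v) = ℘(v)`;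
with `℘'' = 6℘² − g₂/2`, `℘'² = 4℘³ − g₂℘ − g₃` this is the stated quartic (the `3`-division
polynomial, Whittaker–Watson Example 20.5.3). Deliberate dot-notation extension of Mathlib's
`PeriodPair`. [folklore] -/
theorem _root_.PeriodPair.twelve_mul_weierstrassP_pow_four_of_three_mul_mem (L : PeriodPair) {v : ℂ}
    (hv : v ∉ L.lattice) (h3 : 3 * v ∈ L.lattice) :
    12 * ℘[L] v ^ 4 - 6 * L.g₂ * ℘[L] v ^ 2 - 12 * L.g₃ * ℘[L] v - L.g₂ ^ 2 / 4 = 0 := by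
  have h2 : 2 * v ∉ L.lattice := fun h2 ↦ hv (by
    have := L.lattice.sub_mem h3 h2
    rwa [show 3 * v - 2 * v = v by ring] at this)
  have hP' : ℘'[L] v ≠ 0 := L.derivWeierstrassP_ne_zero hv h2
  have hdup := L.weierstrassP_two_mul_holds v hv hP'
  have hper : ℘[L] (2 * v) = ℘[L] v := by
    have := L.weierstrassP_add_coe (-v) ⟨3 * v, h3⟩
    rw [Subtype.coe_mk, show -v + 3 * v = 2 * v by ring, L.weierstrassP_neg] at this
    exact this
  rw [hper, L.deriv_derivWeierstrassP hv, div_pow] at hdup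
  have hsq := L.derivWeierstrassP_sq v hv
  have h' : 3 * ℘[L] v = (6 * ℘[L] v ^ 2 - L.g₂ / 2) ^ 2 / ℘'[L] v ^ 2 / 4 := by
    linear_combination hdup
  have h3P : 3 * ℘[L] v * (4 * ℘'[L] v ^ 2) = (6 * ℘[L] v ^ 2 - L.g₂ / 2) ^ 2 := by
    rw [h']
    field_simp
  rw [hsq] at h3P
  linear_combination h3P

/-- **`3`-division equation for `ℤi + ℤ`**: `v ∉ Λ`, `3v ∈ Λ` imply
`3℘(v)⁴ − 6ϖ₀⁴℘(v)² − ϖ₀⁸ = 0` (`g₂ = 4ϖ₀⁴`, `g₃ = 0`). [folklore] -/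
theorem three_div_quartic {v : ℂ} (hv : v ∉ (Λᵢ).lattice) (h3 : 3 * v ∈ (Λᵢ).lattice) :
    3 * ℘[Λᵢ] v ^ 4 - 6 * ((ϖ₀ : ℝ) : ℂ) ^ 4 * ℘[Λᵢ] v ^ 2 - ((ϖ₀ : ℝ) : ℂ) ^ 8 = 0 := by
  have h := PeriodPair.twelve_mul_weierstrassP_pow_four_of_three_mul_mem _ hv h3
  rw [g₂_eq_varpi', g₃_ofUpperHalfPlane_I] at h
  linear_combination (1 / 4 : ℂ) * h

/-! ### The eight `3`-division points -/

/-- `1/3 ∉ ℤi + ℤ`. [folklore] -/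
theorem one_third_notMem : (1 / 3 : ℂ) ∉ (Λᵢ).lattice := by
  refine notMem_lattice_of_re fun n h ↦ ?_
  norm_num at h
  have h3 : (3 * n : ℝ) = 1 := by linarith
  have : (3 * n : ℤ) = 1 := by exact_mod_cast h3
  omega

/-- `(1+i)/3 ∉ ℤi + ℤ`. [folklore] -/
theorem one_add_I_third_notMem : ((1 + I) / 3 : ℂ) ∉ (Λᵢ).lattice := by
  refine notMem_lattice_of_re fun n h ↦ ?_
  norm_num at h
  have h3 : (3 * n : ℝ) = 1 := by linarith
  have : (3 * n : ℤ) = 1 := by exact_mod_cast h3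
  omega

/-- `(1−i)/3 ∉ ℤi + ℤ`. [folklore] -/
theorem one_sub_I_third_notMem : ((1 - I) / 3 : ℂ) ∉ (Λᵢ).lattice := by
  refine notMem_lattice_of_re fun n h ↦ ?_
  norm_num at h
  have h3 : (3 * n : ℝ) = 1 := by linarith
  have : (3 * n : ℤ) = 1 := by exact_mod_cast h3
  omega

/-- `i/3 ∉ ℤi + ℤ` (`iΛ = Λ`). [folklore] -/
theorem I_third_notMem : (I / 3 : ℂ) ∉ (Λᵢ).lattice := by
  rw [show (I / 3 : ℂ) = I * (1 / 3) by ring, I_mul_mem_lattice_ofUpperHalfPlane_I_iff]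
  exact one_third_notMem

/-- `i ∈ ℤi + ℤ`. [folklore] -/
theorem I_mem : (I : ℂ) ∈ (Λᵢ).lattice :=
  mem_lattice_iff.mpr ⟨1, 0, by push_cast; ring⟩

/-- `1 − i ∈ ℤi + ℤ`. [folklore] -/
theorem one_sub_I_mem : (1 - I : ℂ) ∈ (Λᵢ).lattice :=
  mem_lattice_iff.mpr ⟨-1, 1, by push_cast; ring⟩

/-- **`℘(i/3) = −℘(1/3)`**. [folklore] -/
theorem weierstrassP_I_third : ℘[Λᵢ] (I / 3) = -℘[Λᵢ] (1 / 3) := by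
  rw [show (I / 3 : ℂ) = I * (1 / 3) by ring, weierstrassP_I_mul]

/-- **`℘((1−i)/3) = −℘((1+i)/3)`** (`(1−i)/3 = −i (1+i)/3`). [folklore] -/
theorem weierstrassP_one_sub_I_third : ℘[Λᵢ] ((1 - I) / 3) = -℘[Λᵢ] ((1 + I) / 3) := by
  rw [show ((1 - I) / 3 : ℂ) = -(I * ((1 + I) / 3)) by linear_combination (1 / 3 : ℂ) * I_sq,
    weierstrassP_neg, weierstrassP_I_mul]

/-- `(√3)² = 3` in `ℂ`. [folklore] -/
private theorem sqrt_three_sq : ((Real.sqrt 3 : ℝ) : ℂ) ^ 2 = 3 := by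
  rw [← Complex.ofReal_pow, Real.sq_sqrt (by norm_num)]; push_cast; ring

/-- Real roots of `3t² − 6ϖ₀⁴t − ϖ₀⁸`: `t = (3 ± 2√3)ϖ₀⁴/3`, separated by sign. [folklore] -/
theorem real_quadratic_roots {t : ℝ} (h : 3 * t ^ 2 - 6 * ϖ₀ ^ 4 * t - ϖ₀ ^ 8 = 0) :
    (0 ≤ t → t = (3 + 2 * Real.sqrt 3) / 3 * ϖ₀ ^ 4) ∧
      (t ≤ 0 → t = (3 - 2 * Real.sqrt 3) / 3 * ϖ₀ ^ 4) := by
  have hs : Real.sqrt 3 ^ 2 = 3 := Real.sq_sqrt (by norm_num)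
  have hs1 : 1 < Real.sqrt 3 := by
    rw [show (1 : ℝ) = Real.sqrt 1 from Real.sqrt_one.symm]
    exact Real.sqrt_lt_sqrt (by norm_num) (by norm_num)
  have hw : 0 < ϖ₀ ^ 4 := pow_pos varpi_pos 4
  have hfac : (t - (3 + 2 * Real.sqrt 3) / 3 * ϖ₀ ^ 4) * (t - (3 - 2 * Real.sqrt 3) / 3 * ϖ₀ ^ 4) = 0 := by
    linear_combination (1 / 3 : ℝ) * h - (4 / 9 : ℝ) * ϖ₀ ^ 8 * hs
  have hneg : (3 - 2 * Real.sqrt 3) / 3 * ϖ₀ ^ 4 < 0 :=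
    mul_neg_of_neg_of_pos (by nlinarith) hw
  have hpos : 0 < (3 + 2 * Real.sqrt 3) / 3 * ϖ₀ ^ 4 := by positivity
  constructor
  · intro ht
    rcases mul_eq_zero.mp hfac with h1 | h1
    · linarith
    · exfalso; linarith
  · intro ht
    rcases mul_eq_zero.mp hfac with h1 | h1
    · exfalso; linarith
    · linarith

/-- **`℘(1/3)² = (3 + 2√3)ϖ₀⁴/3`**: `℘(1/3)` is real, so `℘(1/3)² ≥ 0` picks the positive root of
`3X² − 6ϖ₀⁴X − ϖ₀⁸`. [folklore] -/
theorem weierstrassP_third_sq :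
    ℘[Λᵢ] (1 / 3) ^ 2 = (((3 + 2 * Real.sqrt 3) / 3 * ϖ₀ ^ 4 : ℝ) : ℂ) := by
  set p : ℝ := (Λᵢ).weierstrassPRe (1 / 3) with hp
  have hP : ℘[Λᵢ] (1 / 3) = (p : ℂ) := by
    rw [hp, isReal.ofReal_weierstrassPRe]; push_cast; ring_nf
  have hq := three_div_quartic one_third_notMem (by rw [show (3 : ℂ) * (1 / 3) = 1 by norm_num]; exact one_mem)
  rw [hP] at hq
  have hreal' : 3 * p ^ 4 - 6 * ϖ₀ ^ 4 * p ^ 2 - ϖ₀ ^ 8 = 0 := by exact_mod_cast hq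
  have hreal : 3 * (p ^ 2) ^ 2 - 6 * ϖ₀ ^ 4 * p ^ 2 - ϖ₀ ^ 8 = 0 := by
    linear_combination hreal'
  rw [hP, ← Complex.ofReal_pow, (real_quadratic_roots hreal).1 (sq_nonneg p)]

/-- **`℘((1+i)/3)² = (3 − 2√3)ϖ₀⁴/3`**: `℘((1+i)/3)` is purely imaginary
(`conj ℘((1+i)/3) = ℘((1−i)/3) = −℘((1+i)/3)`), so its square is `≤ 0` and picks the negative
root. [folklore] -/
theorem weierstrassP_one_add_I_third_sq :
    ℘[Λᵢ] ((1 + I) / 3) ^ 2 = (((3 - 2 * Real.sqrt 3) / 3 * ϖ₀ ^ 4 : ℝ) : ℂ) := by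
  set P := ℘[Λᵢ] ((1 + I) / 3) with hPdef
  have hc : conj ((1 + I) / 3 : ℂ) = (1 - I) / 3 := by
    rw [map_div₀, map_add, map_one, Complex.conj_I, map_ofNat]; ring
  have hconj : conj P = -P := by
    rw [hPdef, ← isReal.weierstrassP_conj, hc, weierstrassP_one_sub_I_third]
  have hre : P.re = 0 := by
    have := congrArg Complex.re hconj
    simp only [Complex.conj_re, Complex.neg_re] at this
    linarith
  have hPim : P = (P.im : ℂ) * I := by
    apply Complex.ext <;> simp [hre]
  set t : ℝ := -(P.im ^ 2) with ht
  have hP2 : P ^ 2 = (t : ℂ) := by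
    rw [hPim, mul_pow, I_sq, ht]; push_cast; ring
  have hq := three_div_quartic one_add_I_third_notMem
    (by rw [show (3 : ℂ) * ((1 + I) / 3) = 1 + I by ring]; exact one_add_I_mem)
  rw [← hPdef, show P ^ 4 = (P ^ 2) ^ 2 by ring, hP2] at hq
  have hreal : 3 * t ^ 2 - 6 * ϖ₀ ^ 4 * t - ϖ₀ ^ 8 = 0 := by exact_mod_cast hq
  rw [hP2, (real_quadratic_roots hreal).2 (by rw [ht]; nlinarith [sq_nonneg P.im])]

/-! ### `℘'((3+2i)/4)` -/

/-- `(√2)² = 2` in `ℂ`. [folklore] -/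
private theorem sqrt_two_sq' : ((Real.sqrt 2 : ℝ) : ℂ) ^ 2 = 2 := by
  rw [← Complex.ofReal_pow, Real.sq_sqrt (by norm_num)]; push_cast; ring

/-- **`℘'((3+2i)/4) = −2(2 − √2)ϖ₀³`**: the addition theorem for `℘'`
(`PeriodPair.derivWeierstrassP_add_of_ne`) at `u = 1/4`, `v = (1+i)/2`, where
`℘(v) = ℘'(v) = 0`, `℘(u) = (1+√2)ϖ₀²`, `℘'(u) = −2√2(1+√2)ϖ₀³`, `℘(u+v) = (1−√2)ϖ₀²`.
[folklore] -/
theorem derivWeierstrassP_three_add_two_I_quarter :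
    ℘'[Λᵢ] ((3 + 2 * I) / 4) = -(2 * (2 - (Real.sqrt 2 : ℂ)) * ((ϖ₀ : ℝ) : ℂ) ^ 3) := by
  set s : ℂ := (Real.sqrt 2 : ℂ) with hs_def
  set w : ℂ := ((ϖ₀ : ℝ) : ℂ) with hw_def
  have hs2 : s ^ 2 = 2 := sqrt_two_sq'
  have hw0 : w ≠ 0 := by rw [hw_def]; exact Complex.ofReal_ne_zero.mpr varpi_pos.ne'
  have hs1 : 1 + s ≠ 0 := by
    rw [hs_def, ← Complex.ofReal_one, ← Complex.ofReal_add, Complex.ofReal_ne_zero]; positivity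
  have hne : ℘[Λᵢ] (1 / 4) ≠ ℘[Λᵢ] ((1 + I) / 2) := by
    rw [weierstrassP_one_add_I_half]; exact weierstrassP_quarter_ne_zero
  have h := derivWeierstrassP_add_of_ne (L := Λᵢ) one_quarter_notMem one_add_I_half_notMem hne
  rw [show (1 / 4 : ℂ) + (1 + I) / 2 = (3 + 2 * I) / 4 by ring, weierstrassP_one_add_I_half,
    derivWeierstrassP_one_add_I_half, weierstrassP_quarter, derivWeierstrassP_quarter,
    weierstrassP_three_add_two_I_quarter, sub_zero, sub_zero] at h
  rw [h, ← hs_def, ← hw_def,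
    show -(2 * s * (1 + s) * w ^ 3) / ((1 + s) * w ^ 2) = -(2 * s * w) by field_simp]
  linear_combination (-2 : ℂ) * w ^ 3 * hs2

/-! ### The twisted sum of `E₁*` over the `3`-torsion -/

/-- **`E₁*(u+v) + E₁*(u−v) − 2E₁*(u) = ℘'(u)/(℘(u) − ℘(v))`** for `u, v ∉ Λ`, `℘(u) ≠ ℘(v)`
(Armitage–Eberlein (7.64) for `ζ`, `PeriodPair.weierstrassZeta_add_add_sub`; the `ℝ`-linear
correction `π z̄` cancels). [folklore] -/
theorem kroneckerE₁_add_add_sub {u v : ℂ} (hu : u ∉ (Λᵢ).lattice) (hv : v ∉ (Λᵢ).lattice)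
    (hne : ℘[Λᵢ] u ≠ ℘[Λᵢ] v) :
    kroneckerE₁ (u + v) + kroneckerE₁ (u - v) - 2 * kroneckerE₁ u =
      ℘'[Λᵢ] u / (℘[Λᵢ] u - ℘[Λᵢ] v) := by
  rw [kroneckerE₁_def, kroneckerE₁_def, kroneckerE₁_def,
    ← weierstrassZeta_add_add_sub (weierstrassZeta_add_holds (L := Λᵢ)) hu hv hne, map_add, map_sub]
  ring

/-- The **twisted sum of `E₁*` over the non-zero `3`-torsion of `ℂ/(ℤi + ℤ)`**:
`∑_{v ∈ E[3] ∖ 0} κ(v) E₁*(w + v)` with `κ = +1` on `±1/3, ±i/3` and `κ = −1` on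
`±(1+i)/3, ±(1−i)/3` (the quadratic character of `ℤ[i]/3 ≅ 𝔽₉` evaluated at `3v`).
[folklore] -/
def threeTorsionTwistedSum (w : ℂ) : ℂ :=
  kroneckerE₁ (w + 1 / 3) + kroneckerE₁ (w - 1 / 3) +
    (kroneckerE₁ (w + I / 3) + kroneckerE₁ (w - I / 3)) -
    (kroneckerE₁ (w + (1 + I) / 3) + kroneckerE₁ (w - (1 + I) / 3)) -
    (kroneckerE₁ (w + (1 - I) / 3) + kroneckerE₁ (w - (1 - I) / 3))

/-- Unfolding lemma for `threeTorsionTwistedSum`. [folklore] -/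
theorem threeTorsionTwistedSum_def (w : ℂ) : threeTorsionTwistedSum w =
    kroneckerE₁ (w + 1 / 3) + kroneckerE₁ (w - 1 / 3) +
      (kroneckerE₁ (w + I / 3) + kroneckerE₁ (w - I / 3)) -
      (kroneckerE₁ (w + (1 + I) / 3) + kroneckerE₁ (w - (1 + I) / 3)) -
      (kroneckerE₁ (w + (1 - I) / 3) + kroneckerE₁ (w - (1 - I) / 3)) := rfl

/-- **Evaluation of the twisted `3`-torsion sum**: for `w ∉ Λ` with
`D(w) = 3℘(w)⁴ − 6ϖ₀⁴℘(w)² − ϖ₀⁸ ≠ 0`,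
`∑_v κ(v) E₁*(w + v) = 8√3 ϖ₀⁴ ℘(w) ℘'(w) / D(w)`: pairing `v` with `−v` gives
`℘'(w)[1/(℘−P₁) + 1/(℘+P₁) − 1/(℘−P₂) − 1/(℘+P₂)]`, `P₁ = ℘(1/3)`, `P₂ = ℘((1+i)/3)`, and only
`P₁² = (3+2√3)ϖ₀⁴/3`, `P₂² = (3−2√3)ϖ₀⁴/3` enter (`D = 3(℘² − P₁²)(℘² − P₂²)`). [folklore] -/
theorem kroneckerE₁_twisted_three_torsion_sum {w : ℂ} (hw : w ∉ (Λᵢ).lattice)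
    (hD : 3 * ℘[Λᵢ] w ^ 4 - 6 * ((ϖ₀ : ℝ) : ℂ) ^ 4 * ℘[Λᵢ] w ^ 2 - ((ϖ₀ : ℝ) : ℂ) ^ 8 ≠ 0) :
    threeTorsionTwistedSum w = 8 * (Real.sqrt 3 : ℂ) * ((ϖ₀ : ℝ) : ℂ) ^ 4 * ℘[Λᵢ] w * ℘'[Λᵢ] w /
      (3 * ℘[Λᵢ] w ^ 4 - 6 * ((ϖ₀ : ℝ) : ℂ) ^ 4 * ℘[Λᵢ] w ^ 2 - ((ϖ₀ : ℝ) : ℂ) ^ 8) := by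
  set P := ℘[Λᵢ] w with hP
  set P₁ := ℘[Λᵢ] (1 / 3) with hP₁
  set P₂ := ℘[Λᵢ] ((1 + I) / 3) with hP₂
  set ϖ : ℂ := ((ϖ₀ : ℝ) : ℂ) with hϖ
  set s : ℂ := (Real.sqrt 3 : ℂ) with hs
  have hs2 : s ^ 2 = 3 := sqrt_three_sq
  have h1 : P₁ ^ 2 = (3 + 2 * s) / 3 * ϖ ^ 4 := by
    rw [hP₁, weierstrassP_third_sq, hs, hϖ]; push_cast; ring
  have h2 : P₂ ^ 2 = (3 - 2 * s) / 3 * ϖ ^ 4 := by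
    rw [hP₂, weierstrassP_one_add_I_third_sq, hs, hϖ]; push_cast; ring
  -- `D = 3 (P² - P₁²)(P² - P₂²)`, so the four differences are non-zero
  have hfac : 3 * P ^ 4 - 6 * ϖ ^ 4 * P ^ 2 - ϖ ^ 8 = 3 * (P ^ 2 - P₁ ^ 2) * (P ^ 2 - P₂ ^ 2) := by
    rw [h1, h2]; linear_combination (4 / 3 : ℂ) * ϖ ^ 8 * hs2
  have hD' : 3 * (P ^ 2 - P₁ ^ 2) * (P ^ 2 - P₂ ^ 2) ≠ 0 := hfac ▸ hD
  have hA : P ^ 2 - P₁ ^ 2 ≠ 0 := fun h ↦ hD' (by rw [h]; ring)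
  have hB : P ^ 2 - P₂ ^ 2 ≠ 0 := fun h ↦ hD' (by rw [h]; ring)
  have hne1 : P - P₁ ≠ 0 := fun h ↦ hA (by linear_combination (P + P₁) * h)
  have hne1' : P + P₁ ≠ 0 := fun h ↦ hA (by linear_combination (P - P₁) * h)
  have hne2 : P - P₂ ≠ 0 := fun h ↦ hB (by linear_combination (P + P₂) * h)
  have hne2' : P + P₂ ≠ 0 := fun h ↦ hB (by linear_combination (P - P₂) * h)
  -- the four pair sums
  have e1 := kroneckerE₁_add_add_sub hw one_third_notMem (sub_ne_zero.mp hne1)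
  have e2 := kroneckerE₁_add_add_sub hw I_third_notMem (v := I / 3)
    (by rw [weierstrassP_I_third]; exact fun h ↦ hne1' (by rw [hP, hP₁]; linear_combination h))
  have e3 := kroneckerE₁_add_add_sub hw one_add_I_third_notMem (sub_ne_zero.mp hne2)
  have e4 := kroneckerE₁_add_add_sub hw one_sub_I_third_notMem (v := (1 - I) / 3)
    (by rw [weierstrassP_one_sub_I_third]; exact fun h ↦ hne2' (by rw [hP, hP₂]; linear_combination h))
  rw [weierstrassP_I_third, ← hP, ← hP₁, sub_neg_eq_add] at e2
  rw [weierstrassP_one_sub_I_third, ← hP, ← hP₂, sub_neg_eq_add] at e4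
  rw [← hP, ← hP₁] at e1
  rw [← hP, ← hP₂] at e3
  have key : threeTorsionTwistedSum w =
      ℘'[Λᵢ] w / (P - P₁) + ℘'[Λᵢ] w / (P + P₁) - ℘'[Λᵢ] w / (P - P₂) - ℘'[Λᵢ] w / (P + P₂) := by
    rw [threeTorsionTwistedSum_def]
    linear_combination e1 + e2 - e3 - e4
  have eA : ℘'[Λᵢ] w / (P - P₁) + ℘'[Λᵢ] w / (P + P₁) = 2 * P * ℘'[Λᵢ] w / (P ^ 2 - P₁ ^ 2) := by
    rw [div_add_div _ _ hne1 hne1', show (P - P₁) * (P + P₁) = P ^ 2 - P₁ ^ 2 by ring]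
    congr 1; ring
  have eB : ℘'[Λᵢ] w / (P - P₂) + ℘'[Λᵢ] w / (P + P₂) = 2 * P * ℘'[Λᵢ] w / (P ^ 2 - P₂ ^ 2) := by
    rw [div_add_div _ _ hne2 hne2', show (P - P₂) * (P + P₂) = P ^ 2 - P₂ ^ 2 by ring]
    congr 1; ring
  rw [key, show ℘'[Λᵢ] w / (P - P₁) + ℘'[Λᵢ] w / (P + P₁) - ℘'[Λᵢ] w / (P - P₂) - ℘'[Λᵢ] w / (P + P₂)
      = (℘'[Λᵢ] w / (P - P₁) + ℘'[Λᵢ] w / (P + P₁)) - (℘'[Λᵢ] w / (P - P₂) + ℘'[Λᵢ] w / (P + P₂))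
      by ring, eA, eB, hfac, div_sub_div _ _ hA hB, div_eq_div_iff (mul_ne_zero hA hB) hD']
  linear_combination (6 * P * ℘'[Λᵢ] w * (P ^ 2 - P₁ ^ 2) * (P ^ 2 - P₂ ^ 2)) * h1 -
    (6 * P * ℘'[Λᵢ] w * (P ^ 2 - P₁ ^ 2) * (P ^ 2 - P₂ ^ 2)) * h2

/-! ### The two values needed for `L(E₃, 1)` -/

/-- `D(1/4) = 3℘(1/4)⁴ − 6ϖ₀⁴℘(1/4)² − ϖ₀⁸ = 8(4 + 3√2)ϖ₀⁸`. [folklore] -/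
theorem threeDiv_quarter :
    3 * ℘[Λᵢ] (1 / 4) ^ 4 - 6 * ((ϖ₀ : ℝ) : ℂ) ^ 4 * ℘[Λᵢ] (1 / 4) ^ 2 - ((ϖ₀ : ℝ) : ℂ) ^ 8 =
      8 * (4 + 3 * (Real.sqrt 2 : ℂ)) * ((ϖ₀ : ℝ) : ℂ) ^ 8 := by
  rw [weierstrassP_quarter]
  linear_combination (((ϖ₀ : ℝ) : ℂ) ^ 8 * (3 * (Real.sqrt 2 : ℂ) ^ 2 + 12 * (Real.sqrt 2 : ℂ) + 18)) *
    sqrt_two_sq'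

/-- `D((3+2i)/4) = 8(4 − 3√2)ϖ₀⁸`. [folklore] -/
theorem threeDiv_three_add_two_I_quarter :
    3 * ℘[Λᵢ] ((3 + 2 * I) / 4) ^ 4 - 6 * ((ϖ₀ : ℝ) : ℂ) ^ 4 * ℘[Λᵢ] ((3 + 2 * I) / 4) ^ 2 -
        ((ϖ₀ : ℝ) : ℂ) ^ 8 = 8 * (4 - 3 * (Real.sqrt 2 : ℂ)) * ((ϖ₀ : ℝ) : ℂ) ^ 8 := by
  rw [weierstrassP_three_add_two_I_quarter]
  linear_combination (((ϖ₀ : ℝ) : ℂ) ^ 8 * (3 * (Real.sqrt 2 : ℂ) ^ 2 - 12 * (Real.sqrt 2 : ℂ) + 18)) *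
    sqrt_two_sq'

/-- `4 + 3√2 ≠ 0` and `4 − 3√2 ≠ 0` in `ℂ` (`16 ≠ 18`). [folklore] -/
theorem four_add_sub_three_sqrt_two_ne_zero :
    (4 + 3 * (Real.sqrt 2 : ℂ)) ≠ 0 ∧ (4 - 3 * (Real.sqrt 2 : ℂ)) ≠ 0 := by
  have hs : Real.sqrt 2 ^ 2 = 2 := Real.sq_sqrt (by norm_num)
  have h0 : 0 ≤ Real.sqrt 2 := Real.sqrt_nonneg 2
  constructor
  · rw [show (4 + 3 * (Real.sqrt 2 : ℂ)) = ((4 + 3 * Real.sqrt 2 : ℝ) : ℂ) by push_cast; ring,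
      Complex.ofReal_ne_zero]
    positivity
  · rw [show (4 - 3 * (Real.sqrt 2 : ℂ)) = ((4 - 3 * Real.sqrt 2 : ℝ) : ℂ) by push_cast; ring,
      Complex.ofReal_ne_zero]
    intro h
    nlinarith [hs]

/-- **`∑_v κ(v) E₁*(1/4 + v) = −2√3 ϖ₀`** (`℘(1/4)℘'(1/4) = −2(4 + 3√2)ϖ₀⁵`). [folklore] -/
theorem twistedSum_quarter :
    threeTorsionTwistedSum (1 / 4) = -(2 * (Real.sqrt 3 : ℂ) * ((ϖ₀ : ℝ) : ℂ)) := by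
  have hD : 3 * ℘[Λᵢ] (1 / 4) ^ 4 - 6 * ((ϖ₀ : ℝ) : ℂ) ^ 4 * ℘[Λᵢ] (1 / 4) ^ 2 - ((ϖ₀ : ℝ) : ℂ) ^ 8 ≠ 0 := by
    rw [threeDiv_quarter]
    exact mul_ne_zero (mul_ne_zero (by norm_num) four_add_sub_three_sqrt_two_ne_zero.1)
      (pow_ne_zero _ (Complex.ofReal_ne_zero.mpr varpi_pos.ne'))
  have hden : 8 * (4 + 3 * (Real.sqrt 2 : ℂ)) * ((ϖ₀ : ℝ) : ℂ) ^ 8 ≠ 0 :=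
    mul_ne_zero (mul_ne_zero (by norm_num) four_add_sub_three_sqrt_two_ne_zero.1)
      (pow_ne_zero _ (Complex.ofReal_ne_zero.mpr varpi_pos.ne'))
  rw [kroneckerE₁_twisted_three_torsion_sum one_quarter_notMem hD, threeDiv_quarter,
    weierstrassP_quarter, derivWeierstrassP_quarter, div_eq_iff hden]
  set s : ℂ := (Real.sqrt 2 : ℂ) with hs
  set s3 : ℂ := (Real.sqrt 3 : ℂ) with hs3
  set ϖ : ℂ := ((ϖ₀ : ℝ) : ℂ) with hϖ
  have hs2 : s ^ 2 = 2 := sqrt_two_sq'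
  linear_combination (-16 * s3 * ϖ ^ 9 * (s + 2)) * hs2

/-- **`∑_v κ(v) E₁*((3+2i)/4 + v) = −2√3 ϖ₀`** (`℘℘'((3+2i)/4) = −2(4 − 3√2)ϖ₀⁵`). [folklore] -/
theorem twistedSum_three_add_two_I_quarter :
    threeTorsionTwistedSum ((3 + 2 * I) / 4) = -(2 * (Real.sqrt 3 : ℂ) * ((ϖ₀ : ℝ) : ℂ)) := by
  have hD : 3 * ℘[Λᵢ] ((3 + 2 * I) / 4) ^ 4 - 6 * ((ϖ₀ : ℝ) : ℂ) ^ 4 * ℘[Λᵢ] ((3 + 2 * I) / 4) ^ 2 -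
      ((ϖ₀ : ℝ) : ℂ) ^ 8 ≠ 0 := by
    rw [threeDiv_three_add_two_I_quarter]
    exact mul_ne_zero (mul_ne_zero (by norm_num) four_add_sub_three_sqrt_two_ne_zero.2)
      (pow_ne_zero _ (Complex.ofReal_ne_zero.mpr varpi_pos.ne'))
  have hden : 8 * (4 - 3 * (Real.sqrt 2 : ℂ)) * ((ϖ₀ : ℝ) : ℂ) ^ 8 ≠ 0 :=
    mul_ne_zero (mul_ne_zero (by norm_num) four_add_sub_three_sqrt_two_ne_zero.2)
      (pow_ne_zero _ (Complex.ofReal_ne_zero.mpr varpi_pos.ne'))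
  rw [kroneckerE₁_twisted_three_torsion_sum three_add_two_I_quarter_notMem hD,
    threeDiv_three_add_two_I_quarter, weierstrassP_three_add_two_I_quarter,
    derivWeierstrassP_three_add_two_I_quarter, div_eq_iff hden]
  set s : ℂ := (Real.sqrt 2 : ℂ) with hs
  set s3 : ℂ := (Real.sqrt 3 : ℂ) with hs3
  set ϖ : ℂ := ((ϖ₀ : ℝ) : ℂ) with hϖ
  have hs2 : s ^ 2 = 2 := sqrt_two_sq'
  linear_combination (-16 * s3 * ϖ ^ 9) * hs2

end GaussianLattice

end Literature.NumberTheory.EllipticCurves
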